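import Summits.QuantumFields.BalabanUV.T4Continuum.Support.NE7LandauDivBound
import Summits.QuantumFields.BalabanUV.T4Continuum.Support.NE7BalabanGaugeTransport
import Summits.QuantumFields.BalabanUV.T4Continuum.Support.NE3FrameFreeSliceW
import Summits.QuantumFields.BalabanUV.T4Continuum.Spine.NE3.NestedMeanSmoothInterpolant

/-!
# NE7LandauCorrection — THE LETTER (H2) OF F215∕F216 DISCHARGED: every skew torus 1-form `b′` has a Landau correction inside the averaged-kernel gauges — `∃ μ ∈ N(Q′(W))` with
# `R D_W†(b′ − D_Wμ) = 0` and `Q̄_W(D_Wμ) = 0` — because the [B8] (1.38) test space `landauTestsK = span{Δ_W μ : μ ∈ N(Q′(W))}` IS the image of the linear map `μ ↦ Δ_W μ` on the subspace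
# `N(Q′(W))`, `R D_W† b′` lies in it, `R D_W†(D_Wμ) = Δ_Wμ` (F209), and `Q̄_W(D_Wμ) = D(bmean μ) = 0` (lineage #2's gauge transport); HENCE (CP_W), HENCE (P_a) — the first hypothesis of
# the END F204 — rest on ONE row-NE3 letter: (H1) slice Poincaré on `T_A = ker Q̄_W ∩ ker R D_W†` (file 146 of the curved (APE), F217)

Cell `pub-balaban`, rung (B)+1 sub-cell t4, lineage `b2b-balaban-t4-ne7-p1` (CRUX PROVER NE7 #1 = OWNER of row NE7), generation 85; memo
`t4/b2b-balaban-t4-ne7-p1-g85/LAGRANGE-CARRIER.md` §13.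
WHY.  F216 `constrainedPoincare_of_slice_and_landau` left (H1) and (H2).  (H2) is linear algebra on our carrier: `avgKernelGauges` is closed under `+`, real scalars and `0`
(`bmeanIterW_add∕smul`, `skewAdjoint`), `μ ↦ resS (covLapSite W μ)` is linear (`covLapSite_add`, `covLapSite_smul_fun`), so `Submodule.span_induction` turns membership in `landauTestsK`
into a pre-image; the orthogonal projection lands in `landauTestsK` (`Submodule.starProjection_apply_mem`); F209 `landauProj_adjoint_grad_gaugeDir` identifies `R D_W†(D_Wμ)`; and
`NE7BalabanGaugeTransport.QbarIter_gaugeDir_eq_bmean` gives `Q̄_W(D_Wμ) = D_{Q̄W}(bmean μ) = 0` on `N(Q′(W))`.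
WHAT ([folklore]; 0 def, 0 sorry).  §1 `zero_mem_avgKernelGauges`, `add_mem_avgKernelGauges`, `smul_mem_avgKernelGauges`, **`exists_avgKernel_of_mem_landauTestsK`**; §2 `qbarOpK_gaugeDir_eq_zero`
(`Q̄_W(D_Wμ) = 0` on `N(Q′(W))`), **`landau_correction`** ((H2) of F215, for EVERY `b′`); §3 **`constrainedPoincare_of_slicePoincare`** ((CP_W) ⟸ (H1)) and
**`softSymOpKa_posDef_of_slicePoincare`** ((P_a) ⟸ (H1) in F212's regime `28dη·C₁ < 1`, `28dη·C₂ < a`).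
HONEST FRAMING (page 1): (H1) — slice Poincaré on `T_A` with constant `C_T` — remains a HYPOTHESIS (row NE3 proves it on `frameFreeBlockLandauW`, not yet on `T_A`); (CP_W), (P_a) NOT
proved unconditionally; (KL-B) at curved `W` NOT proved; (APE) on curved data NOT proved; NOT ONE-STEP, NOT NE7; spine 0∕9; finite T⁴ rung (B)+1 — NOT infinite volume, NOT mass gap,
NOT `BetaPertH`, NOT Clay.  Continuum YM on T⁴ ⇐ BetaPertH ∧ nine spine estimates (0/9 proved); BetaPertH ⇐ (D1) ∧ (D4) ∧ CAP+tail; G-an2-4 gates asym, D1 and NE2/3/4.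
-/

set_option autoImplicit false

open scoped BigOperators InnerProductSpace Matrix Matrix.Norms.L2Operator
open Finset

namespace Summit.QuantumFields.BalabanUV.T4Continuum.NE7LandauCorrection

open Literature.MathematicalPhysics.QuantumFieldTheory.Balaban1983to89
open B7Prop1Explicit B7Prop2Explicit UnitaryModel MatrixNorms
open T4AveragingDeficitWall (IsUnitaryCfg IsSkewDir SmallField dirSq curlSq)
open T4AveragingDeficitWallBoundary (periodBox IsPeriodicCfg)
open AveragingDeficitPeriodicCounting (IsPeriodicDir)
open AveragingDeficitMultiLevelPrep (LevelSmall tower cavgIter)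
open AveragingDeficitTwoLevelPrep (prop1Radius)
open SpreadLift (loopRad)
open BlockAveragePushDirGauge (gaugeDir isPeriodicDir_gaugeDir)
open NE3HilbertSchmidtTorus
open NE3TangentCovariantTower (QbarIter)
open NE3.PairLandauB8 (avgKernelGauges covLapSite mem_avgKernelGauges_iff)
open NE3.LandauProjectionB8 (covLapSite_add)
open NE3.NestedMeanSmoothInterpolant (covLapSite_smul_fun)
open NE3CovariantBlockMean (bmeanIterW)
open NE3FrameFreeSliceW (bmeanIterW_add bmeanIterW_smul bmeanIterW_zero')
open NE3QbarIterCovLiftPrep (cruxC liftC)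
open NE3RightInverseSolveLetters (thetaLoc)
open NE3FramePotBoundW (tower_eq_pow_mul)
open NE7BalabanSoftOperator
open NE7BalabanSoftOperatorMass
open NE7GaugeFixOnPureGauges (resS_mem_of_avgKernel coe_gradOpK_resS landauProj_adjoint_grad_gaugeDir)
open NE7BalabanGaugeTransport (QbarIter_gaugeDir_eq_bmean)
open NE7ConstrainedPoincareAssembly (landauDiv_sub)
open NE7SoftOperatorEnergyForm (softSymOpKa_posDef_of_constrainedPoincare)
open NE7LandauDivBound (constrainedPoincare_of_slice_and_landau)

noncomputable section

variable {d : ℕ} {n : Type*} [Fintype n] [DecidableEq n]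

/-! ## §1 `landauTestsK` is the image of `N(Q′(W))` under `μ ↦ Δ_W μ` -/

/-- `0 ∈ N(Q′(W))`. [folklore] -/
theorem zero_mem_avgKernelGauges (L N k : ℕ) (W : Site d → Fin d → (Matrix n n ℂ)ˣ) :
    (0 : Site d → Matrix n n ℂ) ∈ avgKernelGauges (d := d) (n := n) L N k W :=
  mem_avgKernelGauges_iff.mpr ⟨fun _ => (skewAdjoint (Matrix n n ℂ)).zero_mem, fun _ _ => rfl, bmeanIterW_zero' L k W⟩

/-- `N(Q′(W))` is closed under addition. [folklore] -/
theorem add_mem_avgKernelGauges {L N k : ℕ} {W : Site d → Fin d → (Matrix n n ℂ)ˣ} {μ ν : Site d → Matrix n n ℂ}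
    (hμ : μ ∈ avgKernelGauges (d := d) (n := n) L N k W) (hν : ν ∈ avgKernelGauges (d := d) (n := n) L N k W) :
    μ + ν ∈ avgKernelGauges (d := d) (n := n) L N k W := by
  obtain ⟨hμs, hμP, hμ0⟩ := mem_avgKernelGauges_iff.mp hμ
  obtain ⟨hνs, hνP, hν0⟩ := mem_avgKernelGauges_iff.mp hν
  refine mem_avgKernelGauges_iff.mpr ⟨fun y => (skewAdjoint (Matrix n n ℂ)).add_mem (hμs y) (hνs y), fun y i => ?_, ?_⟩
  · simp only [Pi.add_apply, hμP y i, hνP y i]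
  · rw [bmeanIterW_add, hμ0, hν0, add_zero]

/-- `N(Q′(W))` is closed under real scalars. [folklore] -/
theorem smul_mem_avgKernelGauges {L N k : ℕ} {W : Site d → Fin d → (Matrix n n ℂ)ˣ} (t : ℝ) {μ : Site d → Matrix n n ℂ}
    (hμ : μ ∈ avgKernelGauges (d := d) (n := n) L N k W) :
    t • μ ∈ avgKernelGauges (d := d) (n := n) L N k W := by
  obtain ⟨hμs, hμP, hμ0⟩ := mem_avgKernelGauges_iff.mp hμ
  refine mem_avgKernelGauges_iff.mpr ⟨fun y => skewAdjoint.smul_mem t (hμs y), fun y i => ?_, ?_⟩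
  · simp only [Pi.smul_apply, hμP y i]
  · rw [bmeanIterW_smul, hμ0, smul_zero]

/-- `Δ_W 0 = 0`. [folklore] -/
theorem covLapSite_zero (W : Site d → Fin d → (Matrix n n ℂ)ˣ) : covLapSite W (0 : Site d → Matrix n n ℂ) = 0 := by
  have h := covLapSite_add W (0 : Site d → Matrix n n ℂ) 0
  rw [add_zero] at h
  funext y
  have hy : covLapSite W (0 : Site d → Matrix n n ℂ) y = covLapSite W (0 : Site d → Matrix n n ℂ) y + covLapSite W (0 : Site d → Matrix n n ℂ) y := by
    have := congrFun h y
    rwa [Pi.add_apply] at this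
  calc covLapSite W (0 : Site d → Matrix n n ℂ) y
      = (covLapSite W (0 : Site d → Matrix n n ℂ) y + covLapSite W (0 : Site d → Matrix n n ℂ) y) - covLapSite W (0 : Site d → Matrix n n ℂ) y := by
        rw [add_sub_cancel_right]
    _ = 0 := by rw [← hy, sub_self]

/-- **`landauTestsK` IS THE IMAGE OF `N(Q′(W))`**: every element of the [B8] (1.38) test space is `resS (Δ_W μ)` for some `μ ∈ N(Q′(W))` (the generating set is already a linear
image of a subspace). [folklore] -/
theorem exists_avgKernel_of_mem_landauTestsK {L N k : ℕ} [NeZero (N * L ^ k)] {W : Site d → Fin d → (Matrix n n ℂ)ˣ} {a : skewSecs d n (N * L ^ k)}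
    (ha : a ∈ landauTestsK (d := d) (n := n) L N k W) :
    ∃ μ ∈ avgKernelGauges (d := d) (n := n) L N k W, (a : Sec d n (N * L ^ k)) = resS (N * L ^ k) (covLapSite W μ) := by
  induction ha using Submodule.span_induction with
  | mem x hx => exact hx
  | zero =>
      refine ⟨0, zero_mem_avgKernelGauges L N k W, ?_⟩
      rw [Submodule.coe_zero, covLapSite_zero]
      ext s : 1; rfl
  | add x y _ _ ihx ihy =>
      obtain ⟨μ, hμ, hx'⟩ := ihx
      obtain ⟨ν, hν, hy'⟩ := ihy
      refine ⟨μ + ν, add_mem_avgKernelGauges hμ hν, ?_⟩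
      rw [Submodule.coe_add, hx', hy', covLapSite_add]
      ext s : 1; rfl
  | smul t x _ ih =>
      obtain ⟨μ, hμ, hx'⟩ := ih
      refine ⟨t • μ, smul_mem_avgKernelGauges t hμ, ?_⟩
      rw [Submodule.coe_smul, hx']
      have hs : covLapSite W (t • μ) = fun y => t • covLapSite W μ y := funext fun y => covLapSite_smul_fun W t μ y
      rw [hs]
      ext s : 1; rfl

/-! ## §2 (H2): the Landau correction inside `N(Q′(W))` -/

section Carrier

variable [Nonempty n] {L N : ℕ} [NeZero N] (hL : 1 ≤ L) (hL2 : 2 ≤ L) (j : ℕ) [NeZero (N * L ^ (j + 1))]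
  {W : Site d → Fin d → (Matrix n n ℂ)ˣ} {x : ℝ} (hWu : IsUnitaryCfg W) (hWP : IsPeriodicCfg W ((N * L ^ (j + 1) : ℕ) : ℤ))
  (hx : 0 ≤ x) (hs : LevelSmall d L j x) (hWx : SmallField W x)
  (hθ : cruxC d L * (((L : ℝ) ^ (j + 1)) ^ 2 * x) < 1) (hθl : thetaLoc d L * (((L : ℝ) ^ (j + 1)) ^ 2 * x) < 1) (hd : 1 ≤ d)

omit [Fintype n] [DecidableEq n] [Nonempty n] in
/-- `resF` of the zero direction vanishes. [folklore] -/
theorem resF_zero_fun (P : ℕ) : resF (d := d) (n := n) P (fun _ _ => (0 : Matrix n n ℂ)) = 0 := by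
  ext p : 1; rfl

include hWP in
/-- **`Q̄_W (D_W μ) = 0` FOR `μ ∈ N(Q′(W))`** — the linearised double-bar average of a pure gauge is the coarse gauge direction of the covariant block mean
(`QbarIter_gaugeDir_eq_bmean`), which vanishes on `N(Q′(W))`. [folklore] -/
theorem qbarOpK_gaugeDir_eq_zero {μ : Site d → Matrix n n ℂ} (hμ : μ ∈ avgKernelGauges (d := d) (n := n) L N (j + 1) W) :
    qbarOpK (N := N) hL j hWu hx hs hWx (gradOpK hWu (N * L ^ (j + 1)) ⟨resS (N * L ^ (j + 1)) μ, resS_mem_of_avgKernel hμ⟩) = 0 := by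
  obtain ⟨hμs, hμP, hμ0⟩ := mem_avgKernelGauges_iff.mp hμ
  have hT : ((tower L N (j + 1) : ℕ) : ℤ) = ((N * L ^ (j + 1) : ℕ) : ℤ) := by rw [tower_eq_pow_mul, Nat.mul_comm]
  have hWP' : IsPeriodicCfg W ((tower L N (j + 1) : ℕ) : ℤ) := by rw [hT]; exact hWP
  have hμP' : ∀ (y : Site d) (i : Fin d), μ (y + ((tower L N (j + 1) : ℕ) : ℤ) • e i) = μ y := by rw [hT]; exact hμP
  apply Subtype.ext
  rw [coe_qbarOpK, Submodule.coe_zero, coe_gradOpK_resS hWu hμ, extF_resF _ (isPeriodicDir_gaugeDir hWP hμP),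
    QbarIter_gaugeDir_eq_bmean hL j hWu hWP' hx hs hWx hμs hμP', hμ0]
  have hg : (fun z κ => gaugeDir (cavgIter L (j + 1) W) (0 : Site d → Matrix n n ℂ) z κ) = fun _ _ => (0 : Matrix n n ℂ) := by
    funext z κ
    simp [gaugeDir]
  rw [hg, resF_zero_fun]

include hWP in
/-- **(H2) OF F215 — THE LANDAU CORRECTION**: for every skew torus 1-form `b′` there is `μ ∈ N(Q′(W))` with `R D†(b′ − D_Wμ) = 0` and `Q̄(D_Wμ) = 0`. [folklore] -/
theorem landau_correction (b' : skewForms d n (N * L ^ (j + 1))) :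
    ∃ μ : Site d → Matrix n n ℂ, ∃ hμ : μ ∈ avgKernelGauges (d := d) (n := n) L N (j + 1) W,
      landauProjK L N (j + 1) W
          ((LinearMap.adjoint (𝕜 := ℝ) (E := skewSecs d n (N * L ^ (j + 1))) (F := skewForms d n (N * L ^ (j + 1))) (gradOpK hWu (N * L ^ (j + 1)))
            : skewForms d n (N * L ^ (j + 1)) →ₗ[ℝ] skewSecs d n (N * L ^ (j + 1))) (b' - gradOpK hWu (N * L ^ (j + 1)) ⟨resS (N * L ^ (j + 1)) μ, resS_mem_of_avgKernel hμ⟩)) = 0 ∧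
      qbarOpK (N := N) hL j hWu hx hs hWx (gradOpK hWu (N * L ^ (j + 1)) ⟨resS (N * L ^ (j + 1)) μ, resS_mem_of_avgKernel hμ⟩) = 0 := by
  have hP : 1 ≤ N * L ^ (j + 1) := Nat.one_le_iff_ne_zero.mpr (NeZero.ne _)
  have hmem : landauProjK L N (j + 1) W
          ((LinearMap.adjoint (𝕜 := ℝ) (E := skewSecs d n (N * L ^ (j + 1))) (F := skewForms d n (N * L ^ (j + 1))) (gradOpK hWu (N * L ^ (j + 1)))
            : skewForms d n (N * L ^ (j + 1)) →ₗ[ℝ] skewSecs d n (N * L ^ (j + 1))) b')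
      ∈ landauTestsK (d := d) (n := n) L N (j + 1) W := by
    haveI : CompleteSpace (landauTestsK (d := d) (n := n) L N (j + 1) W) := FiniteDimensional.complete ℝ _
    exact Submodule.starProjection_apply_mem _ _
  obtain ⟨μ, hμ, hμeq⟩ := exists_avgKernel_of_mem_landauTestsK hmem
  refine ⟨μ, hμ, ?_, qbarOpK_gaugeDir_eq_zero (N := N) hL j hWu hWP hx hs hWx hμ⟩
  rw [landauDiv_sub (N := N) j hWu b' _, sub_eq_zero]
  apply Subtype.ext
  rw [hμeq, landauProj_adjoint_grad_gaugeDir hWu hP hWP hμ]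

/-! ## §3 (CP_W) and (P_a) from the slice Poincaré letter (H1) alone -/

set_option maxHeartbeats 400000 in
include hL2 hWP hθ hθl hd in
/-- **(CP_W) ⟸ (H1)**: F216's `constrainedPoincare_of_slice_and_landau` with (H2) supplied by `landau_correction`. [folklore] -/
theorem constrainedPoincare_of_slicePoincare {η : ℝ} (hWη : SmallField W η)
    (hsmall : 8 * d * (((L : ℝ) ^ (j + 1)) * (((d : ℝ) - 1) * (((L : ℝ) ^ (j + 1)) - 1) * x)) ^ 2
      + 2 * (Fintype.card n * (4 * (d : ℝ) ^ 2 * ((L : ℝ) ^ (j + 1) - 1) ^ 2 * x + 16 * d * loopRad d L ((prop1Radius d L)^[j] x)) ^ 2) ≤ 1 / 2)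
    {CT : ℝ} (hCT : 0 ≤ CT)
    (H1 : ∀ t : skewForms d n (N * L ^ (j + 1)), qbarOpK (N := N) hL j hWu hx hs hWx t = 0 →
      landauProjK L N (j + 1) W
          ((LinearMap.adjoint (𝕜 := ℝ) (E := skewSecs d n (N * L ^ (j + 1))) (F := skewForms d n (N * L ^ (j + 1))) (gradOpK hWu (N * L ^ (j + 1)))
            : skewForms d n (N * L ^ (j + 1)) →ₗ[ℝ] skewSecs d n (N * L ^ (j + 1))) t) = 0 →
      dirSq (extF (N * L ^ (j + 1)) (t : Form d n (N * L ^ (j + 1)))) (periodBox (d := d) (N * L ^ (j + 1)))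
        ≤ CT * curlSq W (extF (N * L ^ (j + 1)) (t : Form d n (N * L ^ (j + 1)))) (periodBox (d := d) (N * L ^ (j + 1))))
    (b : skewForms d n (N * L ^ (j + 1))) :
    dirSq (extF (N * L ^ (j + 1)) (b : Form d n (N * L ^ (j + 1)))) (periodBox (d := d) (N * L ^ (j + 1)))
      ≤ (9 * CT * (Fintype.card n : ℝ)
            + 2 * (4 * Fintype.card n * ((L : ℝ) ^ (j + 1)) ^ 2)
              * (9 * CT * (16 * Fintype.card n * (Fintype.card (T4AveragingDeficitWall.Plane d)) * η ^ 2 * ((L : ℝ) ^ (j + 1)) ^ 2) + 3))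
          * (curlSq W (extF (N * L ^ (j + 1)) (b : Form d n (N * L ^ (j + 1)))) (periodBox (d := d) (N * L ^ (j + 1))) / (Fintype.card n : ℝ)
              + ⟪landauProjK L N (j + 1) W
                  ((LinearMap.adjoint (𝕜 := ℝ) (E := skewSecs d n (N * L ^ (j + 1))) (F := skewForms d n (N * L ^ (j + 1))) (gradOpK hWu (N * L ^ (j + 1)))
                    : skewForms d n (N * L ^ (j + 1)) →ₗ[ℝ] skewSecs d n (N * L ^ (j + 1))) b),
                 landauProjK L N (j + 1) W
                  ((LinearMap.adjoint (𝕜 := ℝ) (E := skewSecs d n (N * L ^ (j + 1))) (F := skewForms d n (N * L ^ (j + 1))) (gradOpK hWu (N * L ^ (j + 1)))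
                    : skewForms d n (N * L ^ (j + 1)) →ₗ[ℝ] skewSecs d n (N * L ^ (j + 1))) b)⟫_ℝ)
        + ((2 * (4 * Fintype.card n * ((L : ℝ) ^ (j + 1)) ^ 2) * (4 * (d : ℝ))
              * (9 * CT * (16 * Fintype.card n * (Fintype.card (T4AveragingDeficitWall.Plane d)) * η ^ 2 * ((L : ℝ) ^ (j + 1)) ^ 2) + 3)
              + 144 * (d : ℝ) * CT + 3)
            * (Fintype.card n * ((liftC d / (1 - thetaLoc d L * (((L : ℝ) ^ (j + 1)) ^ 2 * x))) ^ 2 * (((L : ℝ) ^ (j + 1)) ^ d / ((L : ℝ) ^ (j + 1)) ^ 2))))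
          * ⟪qbarOpK (N := N) hL j hWu hx hs hWx b, qbarOpK (N := N) hL j hWu hx hs hWx b⟫_ℝ :=
  constrainedPoincare_of_slice_and_landau (N := N) hL hL2 j hWu hWP hx hs hWx hθ hθl hd hWη hsmall hCT H1
    (fun b' _ => landau_correction (N := N) hL j hWu hWP hx hs hWx b') b

set_option maxHeartbeats 400000 in
include hL2 hWP hθ hθl hd in
/-- **(P_a) ⟸ (H1)**: positivity of `softSymOpKa a` on the skew torus 1-forms — the hypothesis `hpos` of the END `NE7ApeCurvedRepRoadBPositivityMassEnd` — from the slice Poincaré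
letter (H1) alone, in F212's regime `28dη·C₁ < 1`, `28dη·C₂ < a` (`η ≥ 0` the plaquette radius of `W`; `C₁`, `C₂` the constants of `constrainedPoincare_of_slicePoincare`). [folklore] -/
theorem softSymOpKa_posDef_of_slicePoincare {η : ℝ} (hη : 0 ≤ η) (hWη : SmallField W η)
    (hsmall : 8 * d * (((L : ℝ) ^ (j + 1)) * (((d : ℝ) - 1) * (((L : ℝ) ^ (j + 1)) - 1) * x)) ^ 2
      + 2 * (Fintype.card n * (4 * (d : ℝ) ^ 2 * ((L : ℝ) ^ (j + 1) - 1) ^ 2 * x + 16 * d * loopRad d L ((prop1Radius d L)^[j] x)) ^ 2) ≤ 1 / 2)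
    {CT : ℝ} (hCT : 0 ≤ CT)
    (H1 : ∀ t : skewForms d n (N * L ^ (j + 1)), qbarOpK (N := N) hL j hWu hx hs hWx t = 0 →
      landauProjK L N (j + 1) W
          ((LinearMap.adjoint (𝕜 := ℝ) (E := skewSecs d n (N * L ^ (j + 1))) (F := skewForms d n (N * L ^ (j + 1))) (gradOpK hWu (N * L ^ (j + 1)))
            : skewForms d n (N * L ^ (j + 1)) →ₗ[ℝ] skewSecs d n (N * L ^ (j + 1))) t) = 0 →
      dirSq (extF (N * L ^ (j + 1)) (t : Form d n (N * L ^ (j + 1)))) (periodBox (d := d) (N * L ^ (j + 1)))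
        ≤ CT * curlSq W (extF (N * L ^ (j + 1)) (t : Form d n (N * L ^ (j + 1)))) (periodBox (d := d) (N * L ^ (j + 1))))
    {a : ℝ}
    (hreg1 : 28 * d * η * (9 * CT * (Fintype.card n : ℝ)
            + 2 * (4 * Fintype.card n * ((L : ℝ) ^ (j + 1)) ^ 2)
              * (9 * CT * (16 * Fintype.card n * (Fintype.card (T4AveragingDeficitWall.Plane d)) * η ^ 2 * ((L : ℝ) ^ (j + 1)) ^ 2) + 3)) < 1)
    (hreg2 : 28 * d * η * ((2 * (4 * Fintype.card n * ((L : ℝ) ^ (j + 1)) ^ 2) * (4 * (d : ℝ))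
              * (9 * CT * (16 * Fintype.card n * (Fintype.card (T4AveragingDeficitWall.Plane d)) * η ^ 2 * ((L : ℝ) ^ (j + 1)) ^ 2) + 3)
              + 144 * (d : ℝ) * CT + 3)
            * (Fintype.card n * ((liftC d / (1 - thetaLoc d L * (((L : ℝ) ^ (j + 1)) ^ 2 * x))) ^ 2 * (((L : ℝ) ^ (j + 1)) ^ d / ((L : ℝ) ^ (j + 1)) ^ 2)))) < a) :
    ∀ b : skewForms d n (N * L ^ (j + 1)), b ≠ 0 → 0 < ⟪b, softSymOpKa (N := N) hL j hWu hx hs hWx a b⟫_ℝ :=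
  softSymOpKa_posDef_of_constrainedPoincare (N := N) hL j hWu hx hs hWx hη hWη hreg1 hreg2
    (constrainedPoincare_of_slicePoincare (N := N) hL hL2 j hWu hWP hx hs hWx hθ hθl hd hWη hsmall hCT H1)

end Carrier

end

end Summit.QuantumFields.BalabanUV.T4Continuum.NE7LandauCorrection
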